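import Summits.BirchSwinnertonDyer.BirchSwinnertonDyer.Theorems.PrintX11aLowerHalfThreeNoKodaira
import HarnessLib

/-!
# Crux `X11aLowerHalf` (item stmt-BirchSwinnertonDyer-19064) at `p = 3`: the très-ramifié residual in MAZUR-MAIN-CONJECTURE
# currency (`X2.MazurMainConjectureAt W 3`) — doors, monotonicity from the member currency, and a candidate r15 composition
# (width seat bsd-line-er5-p2 = -w3, p = 3 binder, gen 8; `--supports stmt-BirchSwinnertonDyer-19064` helper; the lead decides)

HONEST FRAMING.  Composition theorems only; no definition, no named fact minted, no `sorry`.  Every theorem is CONDITIONAL and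
closes nothing by itself; the two residual statements of the line (`hS` at `p ≥ 5`, the très-ramifié statement at `p = 3`) stay
OPEN and DISPLAYED.  No summit statement is proved; BSD is proved for no curve and no class.

WHAT THIS FILE SHOWS.  On the registered line «birth» r14 (skeleton 1d0dec24b7f840d5, six stubs) the `p = 3` très-ramifié deep
locus (`3 ∤ ord₃ Δ_min`; 359 ∕ 448 deep X11a classes with `N < 5·10⁵`) is carried by the research statement
`stub_memberRatEqAtTresRamifieThree` in MEMBER currency: «some good-ordinary member `(g, ι)` of `H(E[3])` (level prime to `3`, some
weight) satisfies the rational cyclotomic identity» (X. Wan's Thm. 4 shape, not in print at `3`).  Every road of the line — the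
partner road on the finite-flat locus (`mazurMainConjectureAt_of_multiplicativeCharIdealMuZero`, p632020's file) and the member road
(`OddChain.…missingLowerBoundAt_of_member_of_ratEq_of_multDivisibilityAt`, p617929-era doors) — passes through ONE hinge predicate already
in the tree: `X2.MazurMainConjectureAt W p` (`Rank1Residual/X2/Cells.lean`: Mazur's statement for `E` itself at the multiplicative prime
`p`, Néron-normalised, with the trivial zero; verbatim the conclusion of Skinner 2016 Thm. A, which is printed under (irr) + (ram)).
Hence the très-ramifié residual can be DISPLAYED in that currency:
* §1 `ClassX11a.missingLowerBoundAt_of_mazurMainConjectureAt_of_facts` — at ANY X11a pair, Mazur's statement at the pair + FIVE of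
  the nine shared facts (Stein–Wuthrich 6.1 ×2, GZK, modularity, Greenberg–Stevens) ⟹ the lower half; NO chain fact (no EPW
  weight-`k` instance, no Deligne–Serre, no Hida 3.26, no Kato–Wuthrich A32) is consumed on this branch;
* §2 MONOTONICITY `ClassX11a.mazurMainConjectureAt_three_of_tresRamifie_of_memberRatEqAt_of_facts` — at a très-ramifié X11a pair with
  `p = 3`, the r14 member statement + the chain facts ⟹ Mazur's statement at the pair (the first half of er5-p2 g6's door p634533,
  exposed); so re-cutting the stub from member currency to Mazur currency is MONOTONE: every proof of the registered r14 text closes the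
  re-cut text modulo facts already on the line (class-level form: §4 `Birth.mazurTR_of_memberTR_of_chainFacts`);
* §3 `ThreePartner.lowerThreeDeep_of_partnerFF_of_mazurTR_of_facts` + `Birth.x11aLowerHalf_of_threeDeep_of_children` (GENERIC in the
  `p = 3` deep statement — any future re-cut of the `p = 3` stub composes through it) + `Birth.x11aLowerHalf_of_children_r15`
  (candidate r15: r14 with the sixth child re-cut to `∀ W p, ClassX11a W p → p = 3 → ¬ X11a.ShaAnUnit W p →
  ¬ p ∣ padicValInt p W.minimalDiscriminantInt → X2.MazurMainConjectureAt W p`), its `ErratumRoadFive` spelling; §4 class-level monotonicity; §5 the leaf twins.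
READING.  The research item for the très-ramifié locus becomes the canonical one — Mazur's cyclotomic main conjecture at `p = 3` for a
rank-`0` curve with `3 ‖ N`, `E[3]` irreducible (hence onto), `3 ∤ ord₃ Δ_min`, no (ram) prime —, of which the member statement (X. Wan's Thm. 4
at `3`), Skinner–Urban 3.6.4 at `3` (flagged) and any future multiplicative-`3` analogue of Yan–Zhu ∕ BCS are SUFFICIENT conditions; on this
locus Kato–Wuthrich A32 + Lemma 20 give `char ∣ L_p` integrally, so the open content is ONE divisibility.  Distinct named facts: unchanged (21).
Nothing here is in print at `3`; nothing is asserted.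

References: [Skinner2016PacificMC] Thm. A, §3.2–3.3; [MazurTateTeitelbaum1986Invent] §I.14; [EmertonPollackWeston2006] Thm. 1, 3.1.1,
5.1.3, Cor. 5.1.4; [YanZhu2024MainConjNonCM] Thm. 4.9; [Wan2015] Thm. 4; [Wuthrich2014] Thm. 3, Lemma 20, Prop. 21; [Kato2004Asterisque]
Thm. 12.4, §17.13; [SteinWuthrich2013] Thm. 6.1; [Mazur1978] Cor. 4.1; [GreenbergLNM1716] Conj. 1.11; [BalakrishnanEtAl2019] Thm. 1.2;
[Fisher2012Hessian] Thm. 13.2; [Miller2011LMS] Def. 1.1; cell files `Cruxes/X11aLowerHalf/Lines/birth.lean` (r14), `LEAD-g4-VERDICT.md`.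
-/

set_option autoImplicit false
set_option linter.dupNamespace false -- the directory name repeats the summit name (sibling precedent)

noncomputable section

open scoped Classical MatrixGroups ModularForm

open CongruenceSubgroup UpperHalfPlane WeierstrassCurve IsDedekindDomain Rat.HeightOneSpectrum
  Literature.NumberTheory.EllipticCurves
  Literature.NumberTheory.EllipticCurves.ModularForms
  Literature.NumberTheory.EllipticCurves.Rank1Residual
  Literature.NumberTheory.EllipticCurves.Rank1Residual.Typed
  Literature.NumberTheory.EllipticCurves.Wuthrich2014
  Literature.NumberTheory.EllipticCurves.SteinWuthrich2013
  Literature.NumberTheory.EllipticCurves.Greenberg1999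
  Literature.NumberTheory.EllipticCurves.Kato2004
  Literature.NumberTheory.EllipticCurves.GreenbergVatsal2000
  Literature.NumberTheory.EllipticCurves.EmertonPollackWeston2006
  Literature.NumberTheory.EllipticCurves.SkinnerUrban2014
  Literature.NumberTheory.EllipticCurves.BalakrishnanEtAl2019
  Literature.NumberTheory.GaloisRepresentations
  Literature.NumberTheory.Automorphic
  Summit.BirchSwinnertonDyer.Rank1Residual
  Summit.BirchSwinnertonDyer.Rank1Residual.X11a
  Summit.BirchSwinnertonDyer.BirchSwinnertonDyer.Theorems.OddChain


namespace Summit.BirchSwinnertonDyer.BirchSwinnertonDyer.Theorems.ThreeMazur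

variable {W : WeierstrassCurve ℚ} [W.IsElliptic] [W.IsGloballyMinimal] {p : ℕ} [Fact p.Prime]

/-! ### §1 The door: Mazur's statement at an X11a pair ⟹ the lower half (five shared facts, no chain fact) -/

/-- **The lower half at an X11a pair, ANY prime of the class, from Mazur's statement at the pair** (`hMC :
X2.MazurMainConjectureAt W p`, displayed) and FIVE named facts: Stein–Wuthrich Thm. 6.1 ×2 (`hJs`, `hJn`), GZK (`hGZK`), modularity
(`hNf`), Greenberg–Stevens at the pair (`hGS`) — the rank-`0` height-free socket `bsdp_of_mazurMainConjectureAt_heightFree` and the class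
bridge `missingLowerBoundAt_of_bsdp`.  PER PAIR; CONDITIONAL on `hMC`; closes nothing class-wide.
[cite: SteinWuthrich2013, Thm. 6.1 (p. 20)] [cite: MazurTateTeitelbaum1986Invent, §I.14 (shape only)] [cite: Miller2011LMS, Def. 1.1] -/
theorem _root_.Summit.BirchSwinnertonDyer.Rank1Residual.ClassX11a.missingLowerBoundAt_of_mazurMainConjectureAt_of_facts
    (hNf : exists_isNewformOf) (hJs : thm61_splitMultiplicative) (hJn : thm61_nonsplitMultiplicative)
    (hGZK : rank_eq_analyticRank_of_analyticRank_le_one) (hGS : greenberg_stevens (W := W) (p := p))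
    (hX : ClassX11a W p) (hMC : X2.MazurMainConjectureAt W p) : MissingLowerBoundAt W p := by
  have hmod : hasEntireLFunction_rat := hasEntireLFunction_rat_of_exists_isNewformOf hNf
  have hpar : nonempty_modularParametrizationData :=
    nonempty_modularParametrizationData_of_exists_isNewformOf hNf IsNewformOf.exists_maninConstant_ne_zero_holds
  exact hX.missingLowerBoundAt_of_bsdp hGZK (bsdp_of_mazurMainConjectureAt_heightFree hJs hJn hGZK hmod hpar hGS hX hMC)

/-! ### §2 Monotonicity: the r14 member statement ⟹ Mazur's statement, at a très-ramifié X11a pair with `p = 3` -/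

/-- **At an X11a pair with `p = 3` and `3 ∤ ord₃ Δ_min` (très ramifié, hence onto — `ClassX11a.surj_of_not_dvd` —, hence `3`-adically
onto by Wuthrich's Lemma 20 `h20`): a good-ordinary member of `H(E[3])` with the rational identity (`hmem`, the r14 stub's
conclusion) + the chain facts ⟹ Mazur's statement at the pair** — the first half of er5-p2 g6's door
`missingLowerBoundAt_three_of_tresRamifie_of_memberRatEqAt_of_facts` (p634533), exposed at the hinge `X2.MazurMainConjectureAt`:
Kato–Wuthrich A32 (`hKato`) gives the typed divisibility, x11a-p2's theorem `μ^an(E,3) = 0` modulo Mazur's Manin constant (`hMz`)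
the certificate, the odd-prime chain (EPW 3.1.1 ∕ Thm 1 alg ∕ 5.1.3 weight-`k` instances `h311 hT1a hT1b`, Deligne–Serre `h61`,
Hida 3.26 `h326`, modularity `hNf`) the invariants match, and the endpoint (`hGS`) Mazur's statement.  PER PAIR; CONDITIONAL.
[cite: EmertonPollackWeston2006, Thm. 3.1.1, Thm. 1, Thm. 5.1.3] [cite: Wuthrich2014, Thm. 3 (p. 382), Lemma 20 (p. 399)]
[cite: Mazur1978, Cor. 4.1] [cite: Wan2015, Thm. 4 (p. 4: shape of the member statement only)] -/
theorem _root_.Summit.BirchSwinnertonDyer.Rank1Residual.ClassX11a.mazurMainConjectureAt_three_of_tresRamifie_of_memberRatEqAt_of_facts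
    (hNf : exists_isNewformOf)
    (h311 : thm311_cotorsion_weightK_member_ofLevel_odd) (hT1a : thm1_muAlg_of_weightK_member_ofLevel_odd)
    (hT1b : thm513_transfer_from_weightK_member_of_bdd_ofLevel_odd)
    (h61 : DeligneSerre1974.thm61_exists_adicGaloisRep) (h326 : Hida2000_thm326_ordinary)
    (hKato : kato_charIdeal_dvd_multiplicative_of_surjective) (h20 : lemma20_surjective_threeAdic_of_semistable)
    (hGS : greenberg_stevens (W := W) (p := p)) (hMz : mazur_not_dvd_maninConstant_of_odd)
    (hX : ClassX11a W p) (hp3 : p = 3) (hΔ : ¬ p ∣ padicValInt p W.minimalDiscriminantInt)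
    (hmem : MemberRatEqAt W p) : X2.MazurMainConjectureAt W p := by
  obtain ⟨M, _, hpM, k, g, ι, hmemb, hRat⟩ := hmem
  have hsurj : Surj W p := hX.surj_of_not_dvd W p hΔ
  subst hp3
  have hmod : hasEntireLFunction_rat := hasEntireLFunction_rat_of_exists_isNewformOf hNf
  have hpar : nonempty_modularParametrizationData :=
    nonempty_modularParametrizationData_of_exists_isNewformOf hNf IsNewformOf.exists_maninConstant_ne_zero_holds
  have hμ : X11a.MuAnZeroAt W 3 := MultThreeMuAn.muAnZeroAt_three_of_mult_of_irr hMz W hX.mult hX.irr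
  have hsurj' : ∀ n : ℕ, W.HasSurjectiveModNGaloisRep (3 ^ n : ℕ) := h20 W (Or.inr hX.mult) hsurj
  have hdiv : X11b.MultDivisibilityAt W 3 := multDivisibilityAt_of_kato_of_surjective_pow hKato hX.ne_two hX.mult hsurj'
  have hinv : InvariantsMatchAt W 3 :=
    invariantsMatchAt_of_member_of_ratEq_of_multDivisibilityAt_odd W 3 h311 hT1a hT1b h61 h326 hpar hX.ne_two hX.mult
      hX.irr hdiv hμ hpM g ι hmemb hRat
  exact NonSurjChain.mazurMainConjectureAt_of_invariantsMatchAt_of_multDivisibilityAt hmod W 3 hGS hdiv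
    hX.analyticRank_eq_zero hinv

end Summit.BirchSwinnertonDyer.BirchSwinnertonDyer.Theorems.ThreeMazur

namespace Summit.BirchSwinnertonDyer.BirchSwinnertonDyer.Theorems.ThreePartner

/-! ### §3 The `p = 3` deep statement with the très-ramifié residual in Mazur currency, and the six-children composition r15 -/

/-- **r3's statement `stub_lowerThreeDeep` (the lower half at every deep X11a pair with `p = 3`) with the très-ramifié residual in
MAZUR currency**: finite flat at `3` ⟶ the Hesse-pencil partner (`Birth.exists_goodOrdinary_threeCongruent_partner`, fact-free) and the
THREE-fact partner road (verbatim p641600 §1); très ramifié at `3` ⟶ `hMC3` (Mazur's statement at the pair, OPEN, displayed) through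
§1's door — FIVE shared facts, no chain fact.  CONDITIONAL; closes nothing by itself.
[cite: Fisher2012Hessian, Thm. 13.2 (n = 3)] [cite: EmertonPollackWeston2006, Thm. 1, Cor. 5.1.4] [cite: YanZhu2024MainConjNonCM, Thm. 4.9]
[cite: SteinWuthrich2013, Thm. 6.1 (p. 20)] [cite: Miller2011LMS, Def. 1.1] -/
theorem lowerThreeDeep_of_partnerFF_of_mazurTR_of_facts
    (hNf : exists_isNewformOf)
    (hKato : kato_charIdeal_dvd_multiplicative_of_surjective)
    (h12 : Kato2004.thm12_4) (hns' : Kato2004.exists_multDivisibilityInputs_nonsplit_contra)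
    (hsp' : Kato2004.exists_multDivisibilityInputs_split_contra)
    (hfine' : Kato2004.exists_multDivisibilityInputs_fine_contra)
    (hMz : mazur_not_dvd_maninConstant_of_odd)
    (hJs : thm61_splitMultiplicative) (hJn : thm61_nonsplitMultiplicative)
    (hGZK : rank_eq_analyticRank_of_analyticRank_le_one)
    (hGS : ∀ (W : WeierstrassCurve ℚ) [W.IsElliptic] [W.IsGloballyMinimal] (p : ℕ) [Fact p.Prime],
      p ≠ 2 → greenberg_stevens (W := W) (p := p))
    (hEPW : cor514_transfer_of_goodOrdinary_odd)
    (hYZ : YanZhu2026.thm49_charIdeal_eq_padicLFunction) (hTa : thm1_muAlg_transfer_goodOrdinary_of_mult_odd)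
    (hMC3 : ∀ (W : WeierstrassCurve ℚ) [W.IsElliptic] [W.IsGloballyMinimal] (p : ℕ) [Fact p.Prime],
      ClassX11a W p → p = 3 → ¬ X11a.ShaAnUnit W p → ¬ p ∣ padicValInt p W.minimalDiscriminantInt →
      X2.MazurMainConjectureAt W p) :
    ∀ (W : WeierstrassCurve ℚ) [W.IsElliptic] [W.IsGloballyMinimal] (p : ℕ) [Fact p.Prime],
      ClassX11a W p → p = 3 → ¬ X11a.ShaAnUnit W p → MissingLowerBoundAt W p := by
  intro W _ _ p _ hX hp3 hu
  by_cases hff : p ∣ padicValInt p W.minimalDiscriminantInt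
  · -- finite flat at 3: the Hesse-pencil partner (fact-free) and the THREE-fact partner road, verbatim r14
    subst hp3
    obtain ⟨A, hAE, hAM, hgoodA, hordA, e, he⟩ :=
      Birth.exists_goodOrdinary_threeCongruent_partner W hX.mult (by exact_mod_cast hff)
    exact hX.missingLowerBoundAt_three_of_partner_of_contraFacts_of_theoremB A hNf hEPW hYZ hTa hMz hKato
      Wuthrich2014.lemma20_surjective_threeAdic_of_semistable_holds h12 hns' hsp' hfine' hJs hJn hGZK (hGS W 3 hX.ne_two) rfl
      hgoodA (by exact_mod_cast hordA) ⟨e, he⟩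
  · -- très ramifié at 3: Mazur's statement at the pair (the residual) through §1's door — five shared facts, no chain fact
    exact hX.missingLowerBoundAt_of_mazurMainConjectureAt_of_facts hNf hJs hJn hGZK (hGS W p hX.ne_two)
      (hMC3 W p hX hp3 hu hff)

end Summit.BirchSwinnertonDyer.BirchSwinnertonDyer.Theorems.ThreePartner

namespace Summit.BirchSwinnertonDyer.BirchSwinnertonDyer.Theorems.Birth

/-- **Crux L BY NAME, GENERIC in the `p = 3` deep statement** (`h3`: the lower half at every deep X11a pair with `p = 3`, supplied by
ANY road — r14's `ThreePartner.lowerThreeDeep_of_partnerFF_of_memberTR_of_facts`, r15's `…_of_mazurTR_of_facts`, or a future re-cut):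
unit pairs free; `p = 3` deep ⟵ `h3`; `p ≥ 5` verbatim the r7–r14 body (the both-images certificate from `h48` + `hS` modulo BDMTV, Wan's
member, the surjective ∕ contra doors).  `h9` = the shared nine (U3's text), `h9L` = the nine chain facts (serve `p ≥ 5` only here),
`h48` = item 19948, `hS` = `stub_muAnSurjDeepFive` (OPEN).  CONDITIONAL; closes nothing; BSD is not proved.
[cite: GreenbergLNM1716, §1 Conj. 1.11 (p. 61)] [cite: Wan2015, Thm. 4 (pp. 4–5)] [cite: EmertonPollackWeston2006, Thm. 3.1.1, Thm. 1, Thm. 5.1.3]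
[cite: BalakrishnanEtAl2019, §1 Thm. 1.2] [cite: Miller2011LMS, Def. 1.1 (arXiv:1010.2431 p. 3)] -/
theorem x11aLowerHalf_of_threeDeep_of_children
    (h9 : thm61_splitMultiplicative ∧ thm61_nonsplitMultiplicative ∧
      (∀ (W : WeierstrassCurve ℚ) [W.IsElliptic] [W.IsGloballyMinimal] (p : ℕ) [Fact p.Prime],
        p ≠ 2 → greenberg_stevens (W := W) (p := p)) ∧
      Kato2004.thm12_4 ∧ exists_isNewformOf ∧
      Kato2004.exists_multDivisibilityInputs_nonsplit_contra ∧
      Kato2004.exists_multDivisibilityInputs_split_contra ∧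
      Kato2004.exists_multDivisibilityInputs_fine_contra ∧ mazur_not_dvd_maninConstant_of_odd)
    (h9L : thm311_cotorsion_weightK_member_ofLevel_odd ∧ thm1_muAlg_of_weightK_member_ofLevel_odd ∧
      Wan2015.thm4_rational_weightK_member_of_bdd_ofLevel_irred ∧
      thm513_transfer_from_weightK_member_of_bdd_ofLevel_odd ∧
      DeligneSerre1974.thm61_exists_adicGaloisRep ∧ Hida2000_thm326_ordinary ∧
      kato_charIdeal_dvd_multiplicative_of_surjective ∧
      rank_eq_analyticRank_of_analyticRank_le_one ∧
      thm12_not_le_normalizer_splitCartan)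
    (h48 : Summit.BirchSwinnertonDyer.BirchSwinnertonDyer.Theses.ErratumRoadFive.NonSurjCornerTwinMuAn)
    (hS : ∀ (W : WeierstrassCurve ℚ) [W.IsElliptic] [W.IsGloballyMinimal] (p : ℕ) [Fact p.Prime],
      ClassX11a W p → 5 ≤ p → Surj W p → ¬ X11a.ShaAnUnit W p → X11a.MuAnZeroAt W p)
    (h3 : ∀ (W : WeierstrassCurve ℚ) [W.IsElliptic] [W.IsGloballyMinimal] (p : ℕ) [Fact p.Prime],
      ClassX11a W p → p = 3 → ¬ X11a.ShaAnUnit W p → MissingLowerBoundAt W p) :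
    Summit.BirchSwinnertonDyer.BirchSwinnertonDyer.Theses.PrintX11a.X11aLowerHalf := by
  obtain ⟨hJs, hJn, hGS, h12, hNf, hns', hsp', hfine', hMz⟩ := h9
  obtain ⟨h311, hT1a, hT2, hT1b, h61, h326, hKato, hGZK, hB⟩ := h9L
  have hcert5 : ∀ (W : WeierstrassCurve ℚ) [W.IsElliptic] [W.IsGloballyMinimal] (p : ℕ) [Fact p.Prime],
      ClassX11a W p → 5 ≤ p → ¬ X11a.ShaAnUnit W p → X11a.MuAnZeroAt W p :=
    muAnDeepFive_of_nonSurjCornerTwinMuAn_of_surjDeep hB h48 hS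
  intro W _ _ p hpF hX
  by_cases hu : X11a.ShaAnUnit W p
  · exact x11a_missingLowerBoundAt_of_shaAnUnit hu
  by_cases hp3 : p = 3
  · exact h3 W p hX hp3 hu
  · -- `p ≥ 5`: the certificate + Wan's member + the surjective / contra doors (verbatim the r7–r14 body)
    have hp5 : 5 ≤ p := (Fact.out : p.Prime).five_le_of_ne_two_of_ne_three hX.ne_two hp3
    have hμ : X11a.MuAnZeroAt W p := hcert5 W p hX hp5 hu
    obtain ⟨M, _, hpM, k, g, ι, hmem, hRat⟩ := memberRatEqAt_of_wan_of_five_le W p hNf hT2 hp5 hX.mult hX.irr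
    by_cases hsurj : Surj W p
    · have hsurj' : ∀ n : ℕ, W.HasSurjectiveModNGaloisRep (p ^ n : ℕ) :=
        kato_charIdeal_dvd_multiplicative_of_surjective.surjective_pow_of_five_le W p hp5 hsurj
      exact hX.missingLowerBoundAt_of_member_of_ratEq_of_surjective_pow hNf h311 hT1a hT1b h61 h326 hKato hJs hJn hGZK
        (hGS W p hX.ne_two) hsurj' hμ hpM g ι hmem hRat
    · exact hX.missingLowerBoundAt_of_member_of_ratEq_of_not_surj_contra hNf h311 hT1a hT1b h61 h326 h12 hns' hsp' hfine' hMz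
        hJs hJn hGZK (hGS W p hX.ne_two) hsurj hμ hpM g ι hmem hRat

/-- **Crux L BY NAME from SIX children — candidate r15 «très-ramifié residual in Mazur currency»**: r14's children with the sixth re-cut
to `hMC3 : ∀ W p, ClassX11a W p → p = 3 → ¬ X11a.ShaAnUnit W p → ¬ p ∣ padicValInt p W.minimalDiscriminantInt →
X2.MazurMainConjectureAt W p` (Mazur's cyclotomic statement at `(E, 3)` on the très-ramifié deep X11a locus; OPEN, not in print).  A
skeleton-level composition: `X11aLowerHalf_of := x11aLowerHalf_erratumRoadFive_of_children_r15 stub_nineFactsOddGS stub_chainFactsLower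
stub_threePartnerFactsLower stub_twinMuAn stub_muAnSurjDeepFive stub_mazurMCAtTresRamifieThree`.  CONDITIONAL; closes nothing; BSD is not proved.
[cite: MazurTateTeitelbaum1986Invent, §I.14 (shape only)] [cite: Skinner2016PacificMC, Thm. A (shape only; printed under (ram))]
[cite: GreenbergLNM1716, §1 Conj. 1.11 (p. 61)] [cite: Fisher2012Hessian, Thm. 13.2 (n = 3)] [cite: Miller2011LMS, Def. 1.1] -/
theorem x11aLowerHalf_of_children_r15
    (h9 : thm61_splitMultiplicative ∧ thm61_nonsplitMultiplicative ∧
      (∀ (W : WeierstrassCurve ℚ) [W.IsElliptic] [W.IsGloballyMinimal] (p : ℕ) [Fact p.Prime],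
        p ≠ 2 → greenberg_stevens (W := W) (p := p)) ∧
      Kato2004.thm12_4 ∧ exists_isNewformOf ∧
      Kato2004.exists_multDivisibilityInputs_nonsplit_contra ∧
      Kato2004.exists_multDivisibilityInputs_split_contra ∧
      Kato2004.exists_multDivisibilityInputs_fine_contra ∧ mazur_not_dvd_maninConstant_of_odd)
    (h9L : thm311_cotorsion_weightK_member_ofLevel_odd ∧ thm1_muAlg_of_weightK_member_ofLevel_odd ∧
      Wan2015.thm4_rational_weightK_member_of_bdd_ofLevel_irred ∧
      thm513_transfer_from_weightK_member_of_bdd_ofLevel_odd ∧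
      DeligneSerre1974.thm61_exists_adicGaloisRep ∧ Hida2000_thm326_ordinary ∧
      kato_charIdeal_dvd_multiplicative_of_surjective ∧
      rank_eq_analyticRank_of_analyticRank_le_one ∧
      thm12_not_le_normalizer_splitCartan)
    (hQ3 : cor514_transfer_of_goodOrdinary_odd ∧ YanZhu2026.thm49_charIdeal_eq_padicLFunction ∧
      thm1_muAlg_transfer_goodOrdinary_of_mult_odd)
    (h48 : Summit.BirchSwinnertonDyer.BirchSwinnertonDyer.Theses.ErratumRoadFive.NonSurjCornerTwinMuAn)
    (hS : ∀ (W : WeierstrassCurve ℚ) [W.IsElliptic] [W.IsGloballyMinimal] (p : ℕ) [Fact p.Prime],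
      ClassX11a W p → 5 ≤ p → Surj W p → ¬ X11a.ShaAnUnit W p → X11a.MuAnZeroAt W p)
    (hMC3 : ∀ (W : WeierstrassCurve ℚ) [W.IsElliptic] [W.IsGloballyMinimal] (p : ℕ) [Fact p.Prime],
      ClassX11a W p → p = 3 → ¬ X11a.ShaAnUnit W p → ¬ p ∣ padicValInt p W.minimalDiscriminantInt →
      X2.MazurMainConjectureAt W p) :
    Summit.BirchSwinnertonDyer.BirchSwinnertonDyer.Theses.PrintX11a.X11aLowerHalf := by
  obtain ⟨hJs, hJn, hGS, h12, hNf, hns', hsp', hfine', hMz⟩ := h9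
  obtain ⟨hEPW, hYZ, hTa⟩ := hQ3
  exact x11aLowerHalf_of_threeDeep_of_children ⟨hJs, hJn, hGS, h12, hNf, hns', hsp', hfine', hMz⟩ h9L h48 hS
    (ThreePartner.lowerThreeDeep_of_partnerFF_of_mazurTR_of_facts hNf h9L.2.2.2.2.2.2.1 h12 hns' hsp' hfine' hMz hJs hJn
      h9L.2.2.2.2.2.2.2.1 hGS hEPW hYZ hTa hMC3)

/-- The `ErratumRoadFive` spelling of the six-children composition r15 (one statement under two route names, `Iff.rfl`) — usable as the
skeleton's `X11aLowerHalf_of`. [cite: Miller2011LMS, Def. 1.1 (arXiv:1010.2431 p. 3)] [cite: Fisher2012Hessian, Thm. 13.2 (n = 3)] -/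
theorem x11aLowerHalf_erratumRoadFive_of_children_r15
    (h9 : thm61_splitMultiplicative ∧ thm61_nonsplitMultiplicative ∧
      (∀ (W : WeierstrassCurve ℚ) [W.IsElliptic] [W.IsGloballyMinimal] (p : ℕ) [Fact p.Prime],
        p ≠ 2 → greenberg_stevens (W := W) (p := p)) ∧
      Kato2004.thm12_4 ∧ exists_isNewformOf ∧
      Kato2004.exists_multDivisibilityInputs_nonsplit_contra ∧
      Kato2004.exists_multDivisibilityInputs_split_contra ∧
      Kato2004.exists_multDivisibilityInputs_fine_contra ∧ mazur_not_dvd_maninConstant_of_odd)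
    (h9L : thm311_cotorsion_weightK_member_ofLevel_odd ∧ thm1_muAlg_of_weightK_member_ofLevel_odd ∧
      Wan2015.thm4_rational_weightK_member_of_bdd_ofLevel_irred ∧
      thm513_transfer_from_weightK_member_of_bdd_ofLevel_odd ∧
      DeligneSerre1974.thm61_exists_adicGaloisRep ∧ Hida2000_thm326_ordinary ∧
      kato_charIdeal_dvd_multiplicative_of_surjective ∧
      rank_eq_analyticRank_of_analyticRank_le_one ∧
      thm12_not_le_normalizer_splitCartan)
    (hQ3 : cor514_transfer_of_goodOrdinary_odd ∧ YanZhu2026.thm49_charIdeal_eq_padicLFunction ∧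
      thm1_muAlg_transfer_goodOrdinary_of_mult_odd)
    (h48 : Summit.BirchSwinnertonDyer.BirchSwinnertonDyer.Theses.ErratumRoadFive.NonSurjCornerTwinMuAn)
    (hS : ∀ (W : WeierstrassCurve ℚ) [W.IsElliptic] [W.IsGloballyMinimal] (p : ℕ) [Fact p.Prime],
      ClassX11a W p → 5 ≤ p → Surj W p → ¬ X11a.ShaAnUnit W p → X11a.MuAnZeroAt W p)
    (hMC3 : ∀ (W : WeierstrassCurve ℚ) [W.IsElliptic] [W.IsGloballyMinimal] (p : ℕ) [Fact p.Prime],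
      ClassX11a W p → p = 3 → ¬ X11a.ShaAnUnit W p → ¬ p ∣ padicValInt p W.minimalDiscriminantInt →
      X2.MazurMainConjectureAt W p) :
    Summit.BirchSwinnertonDyer.BirchSwinnertonDyer.Theses.ErratumRoadFive.X11aLowerHalf :=
  x11aLowerHalf_of_children_r15 h9 h9L hQ3 h48 hS hMC3

/-! ### §4 Class-level monotonicity: the registered r14 member text ⟹ the r15 Mazur text, modulo facts on the line -/

/-- **MONOTONICITY of the re-cut (class level)**: the registered r14 stub `stub_memberRatEqAtTresRamifieThree` (member currency, `hM`,
verbatim) together with the chain facts EPW 3.1.1 ∕ Thm 1 alg ∕ 5.1.3 (`h311 hT1a hT1b`), Deligne–Serre (`h61`), Hida 3.26 (`h326`),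
Kato–Wuthrich A32 (`hKato`), GS at odd primes (`hGS`), Mazur 4.1 (`hMz`), modularity (`hNf`) — all ALREADY on the line — and Wuthrich's
Lemma 20 (tree) IMPLIES the r15 text `hMC3`.  So any proof of the r14 text closes the r15 stub; the re-cut loses no road (and r14's six binders give the crux again by
`x11aLowerHalf_of_children_r15 h9 h9L hQ3 h48 hS (mazurTR_of_memberTR_of_chainFacts …)`, statement = p641600's, not re-landed).  CONDITIONAL.
[cite: EmertonPollackWeston2006, Thm. 3.1.1, Thm. 1, Thm. 5.1.3] [cite: Wuthrich2014, Thm. 3, Lemma 20] [cite: Mazur1978, Cor. 4.1] -/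
theorem mazurTR_of_memberTR_of_chainFacts
    (hNf : exists_isNewformOf)
    (h311 : thm311_cotorsion_weightK_member_ofLevel_odd) (hT1a : thm1_muAlg_of_weightK_member_ofLevel_odd)
    (hT1b : thm513_transfer_from_weightK_member_of_bdd_ofLevel_odd)
    (h61 : DeligneSerre1974.thm61_exists_adicGaloisRep) (h326 : Hida2000_thm326_ordinary)
    (hKato : kato_charIdeal_dvd_multiplicative_of_surjective)
    (hGS : ∀ (W : WeierstrassCurve ℚ) [W.IsElliptic] [W.IsGloballyMinimal] (p : ℕ) [Fact p.Prime],
      p ≠ 2 → greenberg_stevens (W := W) (p := p))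
    (hMz : mazur_not_dvd_maninConstant_of_odd)
    (hM : ∀ (W : WeierstrassCurve ℚ) [W.IsElliptic] [W.IsGloballyMinimal] (p : ℕ) [Fact p.Prime],
      ClassX11a W p → p = 3 → ¬ X11a.ShaAnUnit W p → ¬ p ∣ padicValInt p W.minimalDiscriminantInt → MemberRatEqAt W p) :
    ∀ (W : WeierstrassCurve ℚ) [W.IsElliptic] [W.IsGloballyMinimal] (p : ℕ) [Fact p.Prime],
      ClassX11a W p → p = 3 → ¬ X11a.ShaAnUnit W p → ¬ p ∣ padicValInt p W.minimalDiscriminantInt →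
      X2.MazurMainConjectureAt W p :=
  fun W _ _ p _ hX hp3 hu hΔ =>
    hX.mazurMainConjectureAt_three_of_tresRamifie_of_memberRatEqAt_of_facts hNf h311 hT1a hT1b h61 h326 hKato
      Wuthrich2014.lemma20_surjective_threeAdic_of_semistable_holds (hGS W p hX.ne_two) hMz hp3 hΔ (hM W p hX hp3 hu hΔ)

end Summit.BirchSwinnertonDyer.BirchSwinnertonDyer.Theorems.Birth

namespace Summit.BirchSwinnertonDyer.BirchSwinnertonDyer.Theorems.PrintX11aLeaf

/-! ### §5 The route's three open cruxes + parent, and the leaf, from the six children r15 (leaf twins of p641600 §3) -/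

/-- **Route `PrintX11a`'s three open cruxes — L (19064), U3 (20613), U5 (20614) — and the parent 20406, BY NAME, from the six children of
candidate r15** (as `cruxes_of_children_r14` with the sixth child in Mazur currency).  CONDITIONAL; closes nothing; BSD is proved for no curve.
[cite: GreenbergLNM1716, §1 Conj. 1.11 (p. 61)] [cite: Kato2004Asterisque, Thm. 12.4 (p. 221), §17.13 (pp. 279–280)]
[cite: SteinWuthrich2013, Thm. 6.1 (p. 20)] [cite: BalakrishnanEtAl2019, §1 Thm. 1.2] [cite: Miller2011LMS, Def. 1.1] -/
theorem cruxes_of_children_r15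
    (h9 : thm61_splitMultiplicative ∧ thm61_nonsplitMultiplicative ∧
      (∀ (W : WeierstrassCurve ℚ) [W.IsElliptic] [W.IsGloballyMinimal] (p : ℕ) [Fact p.Prime],
        p ≠ 2 → greenberg_stevens (W := W) (p := p)) ∧
      Kato2004.thm12_4 ∧ exists_isNewformOf ∧
      Kato2004.exists_multDivisibilityInputs_nonsplit_contra ∧
      Kato2004.exists_multDivisibilityInputs_split_contra ∧
      Kato2004.exists_multDivisibilityInputs_fine_contra ∧ mazur_not_dvd_maninConstant_of_odd)
    (h9L : thm311_cotorsion_weightK_member_ofLevel_odd ∧ thm1_muAlg_of_weightK_member_ofLevel_odd ∧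
      Wan2015.thm4_rational_weightK_member_of_bdd_ofLevel_irred ∧
      thm513_transfer_from_weightK_member_of_bdd_ofLevel_odd ∧
      DeligneSerre1974.thm61_exists_adicGaloisRep ∧ Hida2000_thm326_ordinary ∧
      kato_charIdeal_dvd_multiplicative_of_surjective ∧
      rank_eq_analyticRank_of_analyticRank_le_one ∧
      thm12_not_le_normalizer_splitCartan)
    (hQ3 : cor514_transfer_of_goodOrdinary_odd ∧ YanZhu2026.thm49_charIdeal_eq_padicLFunction ∧
      thm1_muAlg_transfer_goodOrdinary_of_mult_odd)
    (h48 : Summit.BirchSwinnertonDyer.BirchSwinnertonDyer.Theses.ErratumRoadFive.NonSurjCornerTwinMuAn)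
    (hS : ∀ (W : WeierstrassCurve ℚ) [W.IsElliptic] [W.IsGloballyMinimal] (p : ℕ) [Fact p.Prime],
      ClassX11a W p → 5 ≤ p → Surj W p → ¬ X11a.ShaAnUnit W p → X11a.MuAnZeroAt W p)
    (hMC3 : ∀ (W : WeierstrassCurve ℚ) [W.IsElliptic] [W.IsGloballyMinimal] (p : ℕ) [Fact p.Prime],
      ClassX11a W p → p = 3 → ¬ X11a.ShaAnUnit W p → ¬ p ∣ padicValInt p W.minimalDiscriminantInt →
      X2.MazurMainConjectureAt W p) :
    Summit.BirchSwinnertonDyer.BirchSwinnertonDyer.Theses.PrintX11a.X11aLowerHalf ∧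
      Summit.BirchSwinnertonDyer.BirchSwinnertonDyer.Theses.PrintX11a.UpperNonSurjThree ∧
      Summit.BirchSwinnertonDyer.BirchSwinnertonDyer.Theses.PrintX11a.UpperNonSurjFive ∧
      Summit.BirchSwinnertonDyer.BirchSwinnertonDyer.Theses.PrintX11a.X11aNonSurjEulerHalf := by
  obtain ⟨hJs, hJn, hGS, h12, hnf, hns', hsp', hfine', hMz⟩ := h9
  have hB : thm12_not_le_normalizer_splitCartan := h9L.2.2.2.2.2.2.2.2
  exact ⟨Birth.x11aLowerHalf_of_children_r15 ⟨hJs, hJn, hGS, h12, hnf, hns', hsp', hfine', hMz⟩ h9L hQ3 h48 hS hMC3,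
    upperNonSurjThree_of_nineFacts_oddGS_glue ⟨hJs, hJn, hGS, h12, hnf, hns', hsp', hfine', hMz⟩,
    upperNonSurjFive_of_nonSurjCornerTwinMuAn_of_nineFactsOddGS_glue₃ h48 hB ⟨hJs, hJn, hGS, h12, hnf, hns', hsp', hfine', hMz⟩,
    x11aNonSurjEulerHalf_of_nonSurjCornerTwinMuAn_of_nineFactsOddGS hB h48 hJs hJn hGS h12 hnf hns' hsp' hfine' hMz⟩

/-- **The registered leaf `WAllCornerX11a` (rung W-ALL ∕ 11) DISPLAYED modulo the six children of candidate r15 and Wuthrich 2014 Prop. 21**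
(as `wAllCornerX11a_of_children_r14` with the sixth child in Mazur currency).  CONDITIONAL: the conclusion is an OPEN `@[conjecture]` leaf and is
NOT proved here; the gate records a `conditional-result`; PARTITION 0; BSD is proved for no class.
[cite: Miller2011LMS, Def. 1.1 (arXiv:1010.2431 p. 3)] [cite: Wuthrich2014, Prop. 21 (p. 400)] [cite: GreenbergLNM1716, §1 Conj. 1.11 (p. 61)] -/
theorem wAllCornerX11a_of_children_r15
    (h9 : thm61_splitMultiplicative ∧ thm61_nonsplitMultiplicative ∧
      (∀ (W : WeierstrassCurve ℚ) [W.IsElliptic] [W.IsGloballyMinimal] (p : ℕ) [Fact p.Prime],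
        p ≠ 2 → greenberg_stevens (W := W) (p := p)) ∧
      Kato2004.thm12_4 ∧ exists_isNewformOf ∧
      Kato2004.exists_multDivisibilityInputs_nonsplit_contra ∧
      Kato2004.exists_multDivisibilityInputs_split_contra ∧
      Kato2004.exists_multDivisibilityInputs_fine_contra ∧ mazur_not_dvd_maninConstant_of_odd)
    (h9L : thm311_cotorsion_weightK_member_ofLevel_odd ∧ thm1_muAlg_of_weightK_member_ofLevel_odd ∧
      Wan2015.thm4_rational_weightK_member_of_bdd_ofLevel_irred ∧
      thm513_transfer_from_weightK_member_of_bdd_ofLevel_odd ∧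
      DeligneSerre1974.thm61_exists_adicGaloisRep ∧ Hida2000_thm326_ordinary ∧
      kato_charIdeal_dvd_multiplicative_of_surjective ∧
      rank_eq_analyticRank_of_analyticRank_le_one ∧
      thm12_not_le_normalizer_splitCartan)
    (hQ3 : cor514_transfer_of_goodOrdinary_odd ∧ YanZhu2026.thm49_charIdeal_eq_padicLFunction ∧
      thm1_muAlg_transfer_goodOrdinary_of_mult_odd)
    (h48 : Summit.BirchSwinnertonDyer.BirchSwinnertonDyer.Theses.ErratumRoadFive.NonSurjCornerTwinMuAn)
    (hS : ∀ (W : WeierstrassCurve ℚ) [W.IsElliptic] [W.IsGloballyMinimal] (p : ℕ) [Fact p.Prime],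
      ClassX11a W p → 5 ≤ p → Surj W p → ¬ X11a.ShaAnUnit W p → X11a.MuAnZeroAt W p)
    (hMC3 : ∀ (W : WeierstrassCurve ℚ) [W.IsElliptic] [W.IsGloballyMinimal] (p : ℕ) [Fact p.Prime],
      ClassX11a W p → p = 3 → ¬ X11a.ShaAnUnit W p → ¬ p ∣ padicValInt p W.minimalDiscriminantInt →
      X2.MazurMainConjectureAt W p)
    (hWu : Wuthrich2014.sha_dvd_analyticSha) :
    Summit.BirchSwinnertonDyer.WAllCornerX11a := by
  obtain ⟨hL, -, -, hE⟩ := cruxes_of_children_r15 h9 h9L hQ3 h48 hS hMC3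
  exact Summit.BirchSwinnertonDyer.BirchSwinnertonDyer.Theses.PrintX11a.closes hL hE ⟨hWu, h9L.2.2.2.2.2.2.2.1, h9.2.2.2.2.1⟩

end Summit.BirchSwinnertonDyer.BirchSwinnertonDyer.Theorems.PrintX11aLeaf

end
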